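import Literature.Geometry.Hyperkaehler.AutomorphismsTrivialOnH2LocalSystem
import Literature.Geometry.Kaehler.FixedLocusSubfamily
import HarnessLib

/-!
# Fixed points along Hassett–Tschinkel's local system `Aut°(𝒳/B)`: over the trivialising
# neighbourhood `U` of a fibre `X₀`, a finite-order element `g ∈ Aut°(X₀)` with finitely many fixed
# points has THE SAME NUMBER of fixed points on every fibre `X_b`, `b ∈ U`, as its image under the
# restriction isomorphism `Aut°(X₀) ≅ Aut°(X_b)` (PROVED from the named fact; the one-family step of
# «fixed loci of automorphisms in `Aut₀` deform with the manifold»)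

Layer `Literature/Geometry/Hyperkaehler`; companion of `AutomorphismsTrivialOnH2LocalSystem.lean`
(B. Hassett, Yu. Tschinkel 2013, Thm. 2.1 — the named fact
`HassettTschinkel2013_holAutZero_localSystem`: a local system of groups `Aut°(𝒳/B)` acting
holomorphically and fibrewise on `π⁻¹(U)`, its fibre at `b ∈ U` being `Aut°(𝒳_b)`; g0 proved from
it the global clause `nonempty_mulEquiv`).  This file assembles that fact with the PROVED analytic
fixed-locus package of `Literature/Geometry/Kaehler` (`FixedLocusLocalSection`,
`FixedLocusIsolatedTransversal`, `FixedLocusFiniteFibre`, `FixedLocusSubfamily`: Cartan's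
linearisation, the implicit function theorem on the fixed subspace, counting the sheets of a proper
local homeomorphism) into the ONE-FAMILY form of the principle printed as

  "Since automorphisms in `Aut₀(K)` deform with `K`, their fixed loci deform as well"
  (S. Floccari, Compositio Math. 160 (2024), proof of Lemma 2.2 [`Floccari2024`]; arXiv:2210.02948
  p. 5 L35–L38) and "Proposition (prop:groupaction) shows each `ι_τ` carries over to deformations
  of `X`; thus the fixed-point loci carry over as well" (Hassett–Tschinkel, arXiv:1004.0046 p. 6
  L124–L126 [`HassettTschinkel2013`]),

which is steps (ii)+(iii) of the print-synthesis record
`Literature.AlgebraicGeometry.Hyperkaehler.HassettTschinkel2013_Oguiso2020_fixedPointScheme_translation_kum4Type`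
for ONE family `π : 𝒳 → B` of a deformation chain and the trivialising neighbourhood `U` of ONE of
its fibres.  Cross-ladder literature layer of ladder HodgeAV, rung H3 (cell `hodge-kum4`, sub-home
`lit-family`, tranche LT-H3 (a)+(b)+(c)).

## Statements (tree carriers) and proofs

* `exists_mulEquiv_of_restriction` — the restriction isomorphism WITH its defining property: from
  the clauses of the fact over `U` (multiplicativity of `Φ` on `π⁻¹(U)`, restriction of each `Φ g`
  to the fibre `ι : X ≅ 𝒳_b` lies in `Aut°(X)`, every element of `Aut°(X)` is the restriction of a
  unique `Φ g`) an isomorphism `e : Aut°(X₀) ≃* Aut°(X)` with `Φ g ∘ ι = ι ∘ e g` (the private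
  plumbing of `nonempty_mulEquiv`, now with the compatibility exported).
* `fixedPoints_zpowers_fibre_eq_image` — for `g ∈ A₀` and a fibre identification `ι : X ≅ 𝒳_b`
  intertwining `Φ g` with `h : X ≃ₜ X`, the points of `𝒳_b` fixed by `Φ(⟨g⟩)` are `ι(Fix h)`
  (`Φ (gⁿ) ∘ ι = ι ∘ hⁿ` for `n ∈ ℤ` from multiplicativity and unitality on `π⁻¹(U)`).
* `ncard_fixedPoints_eq_of_restriction` — for `π` a proper holomorphic submersion with `𝒳`
  Hausdorff, `U` open preconnected, `Φ` holomorphic / fibre-preserving / multiplicative / unital on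
  `π⁻¹(U)` for the elements of a subgroup `A₀ ∋ g` of FINITE ORDER, and two fibres `X ≅ 𝒳_b`,
  `X' ≅ 𝒳_{b'}` (`b, b' ∈ U`) on which `Φ g` restricts to `h`, `h'`: if `Fix h` is finite then
  `|Fix h'| = |Fix h|` and `Fix h'` is finite (`Kaehler.ncard_fixedPoints_fibre_eq_of_finite_on` for
  the finite group `⟨g⟩` acting through `Φ`).
* `HassettTschinkel2013_holAutZero_localSystem.exists_nhds_ncard_fixedPoints_eq` — THE ONE-FAMILY
  ENGINE from the fact `h`: for a proper holomorphic submersion of irreducible symplectic manifolds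
  (hypotheses of the fact) and a fibre `ι₀ : X₀ ≅ 𝒳_{b₀}`, there is an open connected `U ∋ b₀` such
  that for every `b ∈ U` and every `ι : X ≅ 𝒳_b` there is `e : Aut°(X₀) ≃* Aut°(X)` with
  `|Fix (e g)| = |Fix g|` (both finite) for every `g ∈ Aut°(X₀)` of finite order with `Fix g` finite.
  Since `e` is a group isomorphism it matches the elements of any given order, so a property «every
  element of order `p` of `Aut°` has exactly `N` fixed points» passes from `X₀` to every `X_b`,
  `b ∈ U` — the clopen step of the chain induction behind F125X (which itself, the induction over
  `IsDeformationEquivalent` and the algebraic ends, is NOT here: Summits-side).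

Everything proved (modulo the named fact taken as a hypothesis `h`, as in `nonempty_mulEquiv`); no
definitions, no instances, no notation, NO new named fact; nothing here asserts HC / HC_Kum4Type.

## Sources

* B. Hassett, Yu. Tschinkel, *Hodge theory and Lagrangian planes on generalized Kummer
  fourfolds*, Mosc. Math. J. 13 (2013) [`HassettTschinkel2013`], §2 Thm. 2.1 (arXiv:1004.0046 p. 3
  L28–L50) and p. 6 L124–L126 (fixed-point loci carry over).
* S. Floccari, *Sixfolds of generalized Kummer type and K3 surfaces*, Compositio Math. 160 (2024)
  [`Floccari2024`], proof of Lemma 2.2 (arXiv:2210.02948 p. 5 L35–L38): "Since automorphisms in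
  `Aut₀(K)` deform with `K`, their fixed loci deform as well."
* B. Edixhoven (1992) Prop. 3.4, H. Cartan (1957) §4, O. Forster (1981) §4.21–4.22 — inputs of the
  fixed-locus package, cited there.
-/

noncomputable section

open scoped Manifold ContDiff Topology
open Function Set Filter
open Literature.Geometry.Kaehler

universe u

namespace Literature.Geometry.Hyperkaehler

/-! ### The restriction isomorphism with its defining property -/

section Restriction

/-- **Restriction to a fibre is a group isomorphism `Aut°(𝒳/B)_{U} ≅ Aut°(X_b)`, compatible with
the action**: from a trivialisation `Φ` of the local system over `U` (multiplicative on a set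
`S ⊇ ι(X)`), the existence clause (`Φ g` restricts along `ι` to an element of `A`) and the
uniqueness clause (every element of `A` is the restriction of a unique `Φ g`, `g ∈ A₀`), an
isomorphism `e : A₀ ≃* A` with `Φ g (ι x) = ι (e g x)`.
[cite: HassettTschinkel2013, §2 Thm. 2.1 («for each b' ∈ B the fiber is isomorphic to Aut°(X')»)] -/
theorem exists_mulEquiv_of_restriction {X₀ X 𝒳 : Type*} [TopologicalSpace X₀]
    [TopologicalSpace X] (A₀ : Subgroup (X₀ ≃ₜ X₀)) (A : Subgroup (X ≃ₜ X))
    (Φ : (X₀ ≃ₜ X₀) → 𝒳 → 𝒳) (ι : X → 𝒳) (hι : Injective ι) (S : Set 𝒳) (hιS : ∀ x, ι x ∈ S)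
    (hmul : ∀ g ∈ A₀, ∀ h ∈ A₀, ∀ x ∈ S, Φ (g * h) x = Φ g (Φ h x))
    (hres : ∀ g ∈ A₀, ∃ h ∈ A, ∀ x, Φ g (ι x) = ι (h x))
    (huniq : ∀ h ∈ A, ∃! g : X₀ ≃ₜ X₀, g ∈ A₀ ∧ ∀ x, Φ g (ι x) = ι (h x)) :
    ∃ e : A₀ ≃* A, ∀ (g : A₀) (x : X), Φ (g : X₀ ≃ₜ X₀) (ι x) = ι ((e g : X ≃ₜ X) x) := by
  classical
  choose r hrA hr using hres
  let ρ : A₀ → A := fun g => ⟨r g.1 g.2, hrA g.1 g.2⟩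
  have hρ : ∀ (g : A₀) (x : X), Φ g.1 (ι x) = ι ((ρ g : X ≃ₜ X) x) := fun g x => hr g.1 g.2 x
  have hρmul : ∀ g h : A₀, ρ (g * h) = ρ g * ρ h := by
    intro g h
    apply Subtype.ext
    ext x
    apply hι
    show ι ((ρ (g * h) : X ≃ₜ X) x) = ι (((ρ g : X ≃ₜ X) * (ρ h : X ≃ₜ X)) x)
    rw [← hρ (g * h) x, Homeomorph.mul_apply, ← hρ g, ← hρ h]
    exact hmul g.1 g.2 h.1 h.2 (ι x) (hιS x)
  have hρinj : Injective ρ := by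
    intro g g' hgg'
    obtain ⟨g₀, -, huq⟩ := huniq (ρ g).1 (ρ g).2
    have h1 : (g : X₀ ≃ₜ X₀) = g₀ := huq g.1 ⟨g.2, fun x => hρ g x⟩
    have h2 : (g' : X₀ ≃ₜ X₀) = g₀ := huq g'.1 ⟨g'.2, fun x => by rw [hgg']; exact hρ g' x⟩
    exact Subtype.ext (h1.trans h2.symm)
  have hρsurj : Surjective ρ := by
    intro h
    obtain ⟨g₀, ⟨hg₀, hg₀'⟩, -⟩ := huniq h.1 h.2
    refine ⟨⟨g₀, hg₀⟩, Subtype.ext ?_⟩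
    ext x
    apply hι
    rw [← hρ ⟨g₀, hg₀⟩ x]
    exact hg₀' x
  exact ⟨MulEquiv.ofBijective (MonoidHom.mk' ρ hρmul) ⟨hρinj, hρsurj⟩, fun g x => hρ g x⟩

end Restriction

/-! ### Fixed points of the cyclic group `⟨g⟩` acting through `Φ`, read on a fibre -/

section Cyclic

variable {X₀ : Type*} [TopologicalSpace X₀] {X : Type*} [TopologicalSpace X] {𝒳 : Type*}
  {B : Type*}

/-- Iterates of a homeomorphism fix its fixed points (`ℕ` powers). [folklore] -/
private theorem pow_apply_eq_self (h : X ≃ₜ X) {x : X} (hx : h x = x) : ∀ n : ℕ, (h ^ n) x = x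
  | 0 => rfl
  | n + 1 => by
    rw [pow_succ, Homeomorph.mul_apply, hx]
    exact pow_apply_eq_self h hx n

/-- Iterates of a homeomorphism fix its fixed points (`ℤ` powers). [folklore] -/
private theorem zpow_apply_eq_self (h : X ≃ₜ X) {x : X} (hx : h x = x) (n : ℤ) :
    (h ^ n) x = x := by
  obtain ⟨m, rfl | rfl⟩ := Int.eq_nat_or_neg n
  · rw [zpow_natCast]; exact pow_apply_eq_self h hx m
  · rw [zpow_neg, zpow_natCast]
    have hm := pow_apply_eq_self h hx m
    calc (h ^ m)⁻¹ x = (h ^ m)⁻¹ ((h ^ m) x) := by rw [hm]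
      _ = x := by rw [← Homeomorph.mul_apply, inv_mul_cancel, Homeomorph.one_apply]

/-- `Φ (gⁿ) ∘ ι = ι ∘ hⁿ` (`n : ℕ`) from `Φ g ∘ ι = ι ∘ h`, multiplicativity and unitality of `Φ`
on a set containing `ι(X)`. [folklore] -/
private theorem apply_pow_eq (A₀ : Subgroup (X₀ ≃ₜ X₀)) (Φ : (X₀ ≃ₜ X₀) → 𝒳 → 𝒳) (S : Set 𝒳)
    (hmul : ∀ g ∈ A₀, ∀ h ∈ A₀, ∀ x ∈ S, Φ (g * h) x = Φ g (Φ h x))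
    (hone : ∀ x ∈ S, Φ 1 x = x) {g : X₀ ≃ₜ X₀} (hg : g ∈ A₀) {ι : X → 𝒳}
    (hιS : ∀ x, ι x ∈ S) (h : X ≃ₜ X) (hh : ∀ x, Φ g (ι x) = ι (h x)) :
    ∀ (n : ℕ) (x : X), Φ (g ^ n) (ι x) = ι ((h ^ n) x)
  | 0, x => by
    rw [pow_zero, pow_zero, Homeomorph.one_apply]
    exact hone _ (hιS x)
  | n + 1, x => by
    rw [pow_succ', pow_succ', hmul g hg (g ^ n) (A₀.pow_mem hg n) _ (hιS x),
      apply_pow_eq A₀ Φ S hmul hone hg hιS h hh n x, hh, Homeomorph.mul_apply]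

/-- `Φ (g⁻¹) ∘ ι = ι ∘ h⁻¹` from `Φ g ∘ ι = ι ∘ h`. [folklore] -/
private theorem apply_inv_eq (A₀ : Subgroup (X₀ ≃ₜ X₀)) (Φ : (X₀ ≃ₜ X₀) → 𝒳 → 𝒳) (S : Set 𝒳)
    (hmul : ∀ g ∈ A₀, ∀ h ∈ A₀, ∀ x ∈ S, Φ (g * h) x = Φ g (Φ h x))
    (hone : ∀ x ∈ S, Φ 1 x = x) {g : X₀ ≃ₜ X₀} (hg : g ∈ A₀) {ι : X → 𝒳}
    (hιS : ∀ x, ι x ∈ S) (h : X ≃ₜ X) (hh : ∀ x, Φ g (ι x) = ι (h x)) (x : X) :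
    Φ g⁻¹ (ι x) = ι (h⁻¹ x) := by
  have h1 : Φ (g⁻¹ * g) (ι (h⁻¹ x)) = Φ g⁻¹ (Φ g (ι (h⁻¹ x))) :=
    hmul g⁻¹ (A₀.inv_mem hg) g hg _ (hιS _)
  rw [inv_mul_cancel, hone _ (hιS _), hh, ← Homeomorph.mul_apply, mul_inv_cancel,
    Homeomorph.one_apply] at h1
  exact h1.symm

/-- `Φ (gⁿ) ∘ ι = ι ∘ hⁿ` for every `n : ℤ`. [folklore] -/
private theorem apply_zpow_eq (A₀ : Subgroup (X₀ ≃ₜ X₀)) (Φ : (X₀ ≃ₜ X₀) → 𝒳 → 𝒳) (S : Set 𝒳)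
    (hmul : ∀ g ∈ A₀, ∀ h ∈ A₀, ∀ x ∈ S, Φ (g * h) x = Φ g (Φ h x))
    (hone : ∀ x ∈ S, Φ 1 x = x) {g : X₀ ≃ₜ X₀} (hg : g ∈ A₀) {ι : X → 𝒳}
    (hιS : ∀ x, ι x ∈ S) (h : X ≃ₜ X) (hh : ∀ x, Φ g (ι x) = ι (h x)) (n : ℤ) (x : X) :
    Φ (g ^ n) (ι x) = ι ((h ^ n) x) := by
  obtain ⟨m, rfl | rfl⟩ := Int.eq_nat_or_neg n
  · rw [zpow_natCast, zpow_natCast]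
    exact apply_pow_eq A₀ Φ S hmul hone hg hιS h hh m x
  · rw [zpow_neg, zpow_natCast, zpow_neg, zpow_natCast, ← inv_pow, ← inv_pow]
    exact apply_pow_eq A₀ Φ S hmul hone (A₀.inv_mem hg) hιS h⁻¹
      (apply_inv_eq A₀ Φ S hmul hone hg hιS h hh) m x

/-- **The points of the fibre `𝒳_b` fixed by `Φ(⟨g⟩)` are the images of the fixed points of the
restriction `h` of `Φ g`**: for `ι : X → 𝒳` injective with image `π⁻¹(b)` (a fibre identification)
intertwining `Φ g` with `h : X ≃ₜ X`, and `Φ` multiplicative and unital on a set containing `ι(X)`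
for the subgroup `A₀ ∋ g`. [cite: HassettTschinkel2013, §2 Thm. 2.1 and p. 6 («the fixed-point loci carry over»)] -/
theorem fixedPoints_zpowers_fibre_eq_image (A₀ : Subgroup (X₀ ≃ₜ X₀))
    (Φ : (X₀ ≃ₜ X₀) → 𝒳 → 𝒳) (S : Set 𝒳)
    (hmul : ∀ g ∈ A₀, ∀ h ∈ A₀, ∀ x ∈ S, Φ (g * h) x = Φ g (Φ h x))
    (hone : ∀ x ∈ S, Φ 1 x = x) {g : X₀ ≃ₜ X₀} (hg : g ∈ A₀)
    {π : 𝒳 → B} {b : B} {ι : X → 𝒳} (hιinj : Injective ι) (hιr : range ι = π ⁻¹' {b})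
    (hιS : ∀ x, ι x ∈ S) (h : X ≃ₜ X) (hh : ∀ x, Φ g (ι x) = ι (h x)) :
    {y : 𝒳 | (∀ k : Subgroup.zpowers g, Φ (k : X₀ ≃ₜ X₀) y = y) ∧ π y = b} =
      ι '' {x : X | h x = x} := by
  ext y
  constructor
  · rintro ⟨hfy, hπy⟩
    have hy : y ∈ range ι := by rw [hιr]; exact hπy
    obtain ⟨x, rfl⟩ := hy
    refine ⟨x, hιinj ?_, rfl⟩
    rw [← hh]
    exact hfy ⟨g, Subgroup.mem_zpowers g⟩
  · rintro ⟨x, hx, rfl⟩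
    refine ⟨fun k => ?_, ?_⟩
    · obtain ⟨n, hn⟩ := Subgroup.mem_zpowers_iff.1 k.2
      rw [← hn, apply_zpow_eq A₀ Φ S hmul hone hg hιS h hh n x, zpow_apply_eq_self h hx n]
    · have hx' : ι x ∈ π ⁻¹' {b} := hιr ▸ mem_range_self x
      exact hx'

end Cyclic

/-! ### The count -/

section Count

variable {E𝒳 : Type*} [NormedAddCommGroup E𝒳] [NormedSpace ℂ E𝒳] [FiniteDimensional ℂ E𝒳]
  {𝒳 : Type*} [TopologicalSpace 𝒳] [ChartedSpace E𝒳 𝒳] [IsManifold 𝓘(ℂ, E𝒳) ω 𝒳]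
  {EB : Type*} [NormedAddCommGroup EB] [NormedSpace ℂ EB]
  {B : Type*} [TopologicalSpace B] [ChartedSpace EB B] [IsManifold 𝓘(ℂ, EB) ω B]
  {X₀ : Type*} [TopologicalSpace X₀] {X : Type*} [TopologicalSpace X]
  {X' : Type*} [TopologicalSpace X']

/-- **Fixed loci of finite-order automorphisms deform with the fibre, fibre to fibre** ("since
automorphisms in `Aut₀` deform with `K`, their fixed loci deform as well"): let `π : 𝒳 → B` be a
proper holomorphic submersion, `𝒳` Hausdorff, `U ⊆ B` open and preconnected, `A₀` a group of
homeomorphisms of `X₀` and `Φ` self-maps of `𝒳`, holomorphic, fibre-preserving, multiplicative and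
unital on `π⁻¹(U)` for the elements of `A₀` (the clauses of
`HassettTschinkel2013_holAutZero_localSystem`); let `g ∈ A₀` have FINITE ORDER and let
`ι : X ≅ 𝒳_b`, `ι' : X' ≅ 𝒳_{b'}` (`b, b' ∈ U`; injective with image the fibre) intertwine `Φ g`
with `h : X ≃ₜ X`, `h' : X' ≃ₜ X'`.  If `Fix h` is finite then `|Fix h'| = |Fix h|` and `Fix h'` is
finite (the finite cyclic group `⟨g⟩` acts through `Φ` on `π⁻¹(U)`;
`Kaehler.ncard_fixedPoints_fibre_eq_of_finite_on`).
[cite: HassettTschinkel2013, §2 Thm. 2.1 and p. 6 («the fixed-point loci carry over»)]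
[cite: Floccari2024, §2 Lemma 2.2 (proof: «their fixed loci deform as well»)] -/
theorem ncard_fixedPoints_eq_of_restriction [T2Space 𝒳] {π : 𝒳 → B}
    (hπ : IsProperHolomorphicSubmersion E𝒳 EB π) {U : Set B} (hUo : IsOpen U)
    (hUc : IsPreconnected U) (A₀ : Subgroup (X₀ ≃ₜ X₀)) (Φ : (X₀ ≃ₜ X₀) → 𝒳 → 𝒳)
    (hhol : ∀ g ∈ A₀, ContMDiffOn 𝓘(ℂ, E𝒳) 𝓘(ℂ, E𝒳) ω (Φ g) (π ⁻¹' U))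
    (hfib : ∀ g ∈ A₀, ∀ x ∈ π ⁻¹' U, π (Φ g x) = π x)
    (hmul : ∀ g ∈ A₀, ∀ h ∈ A₀, ∀ x ∈ π ⁻¹' U, Φ (g * h) x = Φ g (Φ h x))
    (hone : ∀ x ∈ π ⁻¹' U, Φ 1 x = x)
    {g : X₀ ≃ₜ X₀} (hg : g ∈ A₀) (hgo : IsOfFinOrder g)
    {b : B} (hb : b ∈ U) {ι : X → 𝒳} (hιinj : Injective ι) (hιr : range ι = π ⁻¹' {b})
    (h : X ≃ₜ X) (hh : ∀ x, Φ g (ι x) = ι (h x))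
    {b' : B} (hb' : b' ∈ U) {ι' : X' → 𝒳} (hι'inj : Injective ι') (hι'r : range ι' = π ⁻¹' {b'})
    (h' : X' ≃ₜ X') (hh' : ∀ x, Φ g (ι' x) = ι' (h' x))
    (hfin : {x : X | h x = x}.Finite) :
    {x : X' | h' x = x}.ncard = {x : X | h x = x}.ncard ∧ {x : X' | h' x = x}.Finite := by
  classical
  haveI : Finite (Subgroup.zpowers g) := hgo.finite_zpowers
  have hιS : ∀ x, ι x ∈ π ⁻¹' U := fun x => by
    have hx : ι x ∈ π ⁻¹' {b} := hιr ▸ mem_range_self x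
    show π (ι x) ∈ U
    rw [show π (ι x) = b from hx]; exact hb
  have hι'S : ∀ x, ι' x ∈ π ⁻¹' U := fun x => by
    have hx : ι' x ∈ π ⁻¹' {b'} := hι'r ▸ mem_range_self x
    show π (ι' x) ∈ U
    rw [show π (ι' x) = b' from hx]; exact hb'
  -- the finite cyclic group `⟨g⟩` acting through `Φ`
  set Ψ : Subgroup.zpowers g → 𝒳 → 𝒳 := fun k => Φ (k : X₀ ≃ₜ X₀) with hΨdef
  have hle : Subgroup.zpowers g ≤ A₀ := Subgroup.zpowers_le.2 hg
  have hS := fixedPoints_zpowers_fibre_eq_image A₀ Φ (π ⁻¹' U) hmul hone hg hιinj hιr hιS h hh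
  have hS' := fixedPoints_zpowers_fibre_eq_image A₀ Φ (π ⁻¹' U) hmul hone hg hι'inj hι'r hι'S
    h' hh'
  have hfinb : {y : 𝒳 | (∀ k : Subgroup.zpowers g, Ψ k y = y) ∧ π y = b}.Finite := by
    show {y : 𝒳 | (∀ k : Subgroup.zpowers g, Φ (k : X₀ ≃ₜ X₀) y = y) ∧ π y = b}.Finite
    rw [hS]; exact hfin.image ι
  obtain ⟨h1, h2⟩ := ncard_fixedPoints_fibre_eq_of_finite_on hπ hUo hUc Ψ
    (fun k => hhol k.1 (hle k.2)) (fun k => hfib k.1 (hle k.2))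
    (fun k l x hx => hmul k.1 (hle k.2) l.1 (hle l.2) x hx) hone hb hfinb hb'
  have h1' : (ι' '' {x : X' | h' x = x}).ncard = (ι '' {x : X | h x = x}).ncard := by
    rw [← hS, ← hS']; exact h1
  have h2' : (ι' '' {x : X' | h' x = x}).Finite := by rw [← hS']; exact h2
  rw [Set.ncard_image_of_injective _ hι'inj, Set.ncard_image_of_injective _ hιinj] at h1'
  exact ⟨h1', Set.Finite.of_finite_image h2' hι'inj.injOn⟩

end Count

/-! ### From the named fact: the one-family engine -/

section LocalSystem

variable {E𝒳 : Type u} [NormedAddCommGroup E𝒳] [NormedSpace ℂ E𝒳] [FiniteDimensional ℂ E𝒳]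
  {𝒳 : Type u} [TopologicalSpace 𝒳] [ChartedSpace E𝒳 𝒳] [IsManifold 𝓘(ℂ, E𝒳) ω 𝒳]
  [T2Space 𝒳] [SecondCountableTopology 𝒳]
  {EB : Type u} [NormedAddCommGroup EB] [NormedSpace ℂ EB] [FiniteDimensional ℂ EB]
  {B : Type u} [TopologicalSpace B] [ChartedSpace EB B] [IsManifold 𝓘(ℂ, EB) ω B]
  [T2Space B] [SecondCountableTopology B] [ConnectedSpace B]
  {π : 𝒳 → B}

/-- **Hassett–Tschinkel 2013, Thm. 2.1 ⇒ fixed loci of `Aut°` deform with the fibre (the one-family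
engine, PROVED from the fact).**  Along a proper holomorphic submersion `π : 𝒳 → B` of irreducible
symplectic manifolds (the hypotheses of `HassettTschinkel2013_holAutZero_localSystem`), for every
fibre `ι₀ : X₀ ≅ 𝒳_{b₀}` there is an open connected `U ∋ b₀` such that for every `b ∈ U` and every
`ι : X ≅ 𝒳_b` there is a group isomorphism `e : Aut°(X₀) ≃* Aut°(X)` under which every `g ∈ Aut°(X₀)`
of finite order with finitely many fixed points goes to an element with THE SAME NUMBER of fixed
points (finitely many).  As `e` preserves orders, «every element of order `p` of `Aut°` has exactly
`N` fixed points» thus passes from `X₀` to every `X_b`, `b ∈ U`.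
[cite: HassettTschinkel2013, §2 Thm. 2.1 and p. 6 («the fixed-point loci carry over»)]
[cite: Floccari2024, §2 Lemma 2.2 (proof: «their fixed loci deform as well»)] -/
theorem HassettTschinkel2013_holAutZero_localSystem.exists_nhds_ncard_fixedPoints_eq
    (h : HassettTschinkel2013_holAutZero_localSystem.{u})
    (hπ : IsProperHolomorphicSubmersion E𝒳 EB π)
    (hIHS : ∀ b : B, ∃ (X : ComplexManifold.{u}) (ι : X → 𝒳),
      IsFibreEmbedding X.model E𝒳 π b ι ∧ X.IsIrreducibleSymplectic)
    (b₀ : B) (X₀ : ComplexManifold.{u}) (ι₀ : X₀ → 𝒳) (hι₀ : IsFibreEmbedding X₀.model E𝒳 π b₀ ι₀) :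
    ∃ U : Set B, IsOpen U ∧ IsConnected U ∧ b₀ ∈ U ∧
      ∀ b ∈ U, ∀ (X : ComplexManifold.{u}) (ι : X → 𝒳), IsFibreEmbedding X.model E𝒳 π b ι →
        ∃ e : holAutZero X₀.model X₀ ≃* holAutZero X.model X,
          ∀ g : holAutZero X₀.model X₀, IsOfFinOrder (g : X₀ ≃ₜ X₀) →
            {x : X₀ | (g : X₀ ≃ₜ X₀) x = x}.Finite →
              {x : X | ((e g : holAutZero X.model X) : X ≃ₜ X) x = x}.ncard =
                  {x : X₀ | (g : X₀ ≃ₜ X₀) x = x}.ncard ∧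
                {x : X | ((e g : holAutZero X.model X) : X ≃ₜ X) x = x}.Finite := by
  obtain ⟨U, hUo, hUc, hb₀U, Φ, hsec, hmul, hone, hfib⟩ := h hπ hIHS b₀ X₀ ι₀ hι₀
  refine ⟨U, hUo, hUc, hb₀U, fun b hb X ι hι => ?_⟩
  obtain ⟨hres, huniq⟩ := hfib b hb X ι hι
  have hιS : ∀ x, ι x ∈ π ⁻¹' U := fun x => by
    show π (ι x) ∈ U
    rw [hι.apply_eq x]; exact hb
  obtain ⟨e, he⟩ := exists_mulEquiv_of_restriction (holAutZero X₀.model X₀) (holAutZero X.model X)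
    Φ ι hι.isClosedEmbedding.injective (π ⁻¹' U) hιS hmul hres huniq
  refine ⟨e, fun g hgo hgfin => ?_⟩
  exact ncard_fixedPoints_eq_of_restriction hπ hUo hUc.isPreconnected (holAutZero X₀.model X₀) Φ
    (fun g hg => (hsec g hg).1) (fun g hg => (hsec g hg).2.1) hmul hone g.2 hgo hb₀U
    hι₀.isClosedEmbedding.injective hι₀.range_eq (g : X₀ ≃ₜ X₀) (fun x => (hsec g.1 g.2).2.2 x)
    hb hι.isClosedEmbedding.injective hι.range_eq ((e g : holAutZero X.model X) : X ≃ₜ X)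
    (fun x => he g x) hgfin

end LocalSystem

end Literature.Geometry.Hyperkaehler

end
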